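import Literature.Combinatorics.StablePolynomials.GraceApolarity
import Literature.Combinatorics.StablePolynomials.GraceWalshSzegoDisk
import HarnessLib

/-!
# Grace's apolarity theorem for disks (Borcea–Brändén II, Theorems 5.1 and 5.2 with `C` a disk)

J. Borcea, P. Brändén, *The Lee–Yang and Pólya–Schur programs. II.*, Comm. Pure Appl. Math. 62 (2009)
1595–1631 (arXiv:0809.3087), §5:

> **Theorem 5.1 (Grace).** Let `f` and `g` be apolar polynomials of degree `n ≥ 1`. If `f` has all zeros
> in a circular domain `C` then `g` has at least one zero in `C`.
>
> **Theorem 5.2.** Let `f` and `g` be polynomials of degree `n ≥ 1` and `C` be a circular domain. If `f` is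
> `C`-stable and `g` is `ℂ ∖ C`-stable then `{f,g}_n ≠ 0`.

The tree (`GraceApolarity.lean`) has both for half-planes, through the identity
`{f,g}_n = lc(g) · n! · Π↑(f)(β_1,…,β_n)` at the roots `β` of `g` (`eval_roots_polarization_eq_zero_of_apolar`)
and the Grace–Walsh–Szegő theorem for half-planes. With the Grace–Walsh–Szegő theorem for disks
(`GraceWalshSzegoDisk.lean`) the same argument gives the classical disk versions: if `{f,g}_n = 0`,
`deg f ≤ n = deg g` and all zeros of `g` lie in a disk `D` (open or closed), then `Π↑(f)` vanishes at the
roots of `g`, which lie in `D`, so `Π↑(f)(ζ,…,ζ) = f(ζ) = 0` for some `ζ ∈ D`.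

-- TODO(general form): exteriors of disks (non-convex circular domains; total-degree hypothesis).

## Contents

* **`exists_root_of_apolar_of_roots_mem_ball`**, **`exists_root_of_apolar_of_roots_mem_closedBall`** — Grace's
  theorem for open / closed disks (`{f,g}_n = 0`, `deg g ≤ n = deg f`, zeros of `f` in `D` ⟹ a zero of
  `g` in `D`), with the unit-disk specialisations `exists_root_norm_lt_one_of_apolar`,
  `exists_root_norm_le_one_of_apolar`.
* **`apolarForm_ne_zero_of_diskStable`** — Theorem 5.2 for `C = 𝔻`: `f` `𝔻`-stable, `g` `(ℂ ∖ 𝔻)`-stable,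
  `deg f ≤ n = deg g` ⟹ `{f,g}_n ≠ 0`; `apolarForm_ne_zero_of_diskStable'` (rôles of `𝔻`, `ℂ ∖ 𝔻`
  exchanged, `deg g ≤ n = deg f`).

## References

* [BorceaBranden2009II] J. Borcea, P. Brändén, Comm. Pure Appl. Math. 62 (2009) 1595–1631, §5 Thms 5.1, 5.2.
* [KungRotaYan2009] J. P. S. Kung, G.-C. Rota, C. H. Yan, *Combinatorics: The Rota Way*, §6.3.
-/

noncomputable section

open MvPolynomial Finset

namespace Literature.Combinatorics.StablePolynomials

/-! ## §1 Grace's theorem for disks -/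

section Grace

/-- **Grace's theorem for an open disk** `D = {z : |z - c| < r}`: if `{f,g}_n = 0`, `deg g ≤ n = deg f`,
`f ≠ 0`, and all zeros of `f` lie in `D`, then `g` has a zero in `D`. Proof: the roots `β_1,…,β_n` of `f`
lie in `D` and `Π↑(g)(β) = ± {f,g}_n /(lc(f) n!) = 0`; the Grace–Walsh–Szegő theorem for `D` gives
`ζ ∈ D` with `g(ζ) = Π↑(g)(ζ,…,ζ) = Π↑(g)(β) = 0`. [cite: BorceaBranden2009II, §5 Thm. 5.1 (`C` an open
disk)] [cite: KungRotaYan2009, §6.3 Prop. 6.3.5] -/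
theorem exists_root_of_apolar_of_roots_mem_ball {n : ℕ} {f g : Polynomial ℂ} (hf : f.natDegree = n)
    (hf0 : f ≠ 0) (hg : g.natDegree ≤ n) (h : apolarForm n f g = 0) (c : ℂ) {r : ℝ} (hr : 0 < r)
    (hzeros : ∀ z : ℂ, f.eval z = 0 → ‖z - c‖ < r) : ∃ z : ℂ, ‖z - c‖ < r ∧ g.eval z = 0 := by
  -- `{g,f}_n = ± {f,g}_n = 0`
  have h' : apolarForm n g f = 0 := by rw [apolarForm_symm, h, mul_zero]
  set l := f.roots.toList with hl
  have hlen : l.length = n := by rw [hl, length_roots_toList, hf]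
  have hF0 := eval_roots_polarization_eq_zero_of_apolar hf hf0 h'
  -- the roots of `f` lie in `D`
  have hβ : ∀ j : Fin l.length, ‖l[j.1] - c‖ < r := fun j =>
    hzeros _ (Polynomial.isRoot_of_mem_roots (Multiset.mem_toList.1 (List.getElem_mem j.2))).eq_zero
  obtain ⟨ζ, hζ, hval⟩ := exists_eval_eq_eval_const_of_mem_ball (isMultiAffine_polarization g)
    (rename_perm_polarization · g) c hr (fun j : Fin l.length => l[j.1]) hβ
  rw [hF0, eval_const_polarization (by rw [Fintype.card_fin, hlen]; exact hg)] at hval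
  exact ⟨ζ, hζ, hval.symm⟩

/-- **Grace's theorem for a closed disk** `D = {z : |z - c| ≤ r}` (`r > 0`): if `{f,g}_n = 0`,
`deg g ≤ n = deg f`, `f ≠ 0`, and all zeros of `f` lie in `D`, then `g` has a zero in `D`.
[cite: BorceaBranden2009II, §5 Thm. 5.1 (`C` a closed disk)] [cite: KungRotaYan2009, §6.3 Prop. 6.3.5] -/
theorem exists_root_of_apolar_of_roots_mem_closedBall {n : ℕ} {f g : Polynomial ℂ} (hf : f.natDegree = n)
    (hf0 : f ≠ 0) (hg : g.natDegree ≤ n) (h : apolarForm n f g = 0) (c : ℂ) {r : ℝ} (hr : 0 < r)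
    (hzeros : ∀ z : ℂ, f.eval z = 0 → ‖z - c‖ ≤ r) : ∃ z : ℂ, ‖z - c‖ ≤ r ∧ g.eval z = 0 := by
  have h' : apolarForm n g f = 0 := by rw [apolarForm_symm, h, mul_zero]
  set l := f.roots.toList with hl
  have hlen : l.length = n := by rw [hl, length_roots_toList, hf]
  have hF0 := eval_roots_polarization_eq_zero_of_apolar hf hf0 h'
  have hβ : ∀ j : Fin l.length, ‖l[j.1] - c‖ ≤ r := fun j =>
    hzeros _ (Polynomial.isRoot_of_mem_roots (Multiset.mem_toList.1 (List.getElem_mem j.2))).eq_zero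
  obtain ⟨ζ, hζ, hval⟩ := exists_eval_eq_eval_const_of_mem_closedBall (isMultiAffine_polarization g)
    (rename_perm_polarization · g) c hr (fun j : Fin l.length => l[j.1]) hβ
  rw [hF0, eval_const_polarization (by rw [Fintype.card_fin, hlen]; exact hg)] at hval
  exact ⟨ζ, hζ, hval.symm⟩

/-- **Grace's theorem for the open unit disk.** [cite: BorceaBranden2009II, §5 Thm. 5.1 (`C = 𝔻`)] -/
theorem exists_root_norm_lt_one_of_apolar {n : ℕ} {f g : Polynomial ℂ} (hf : f.natDegree = n) (hf0 : f ≠ 0)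
    (hg : g.natDegree ≤ n) (h : apolarForm n f g = 0) (hzeros : ∀ z : ℂ, f.eval z = 0 → ‖z‖ < 1) :
    ∃ z : ℂ, ‖z‖ < 1 ∧ g.eval z = 0 := by
  obtain ⟨z, hz, hgz⟩ := exists_root_of_apolar_of_roots_mem_ball hf hf0 hg h 0 one_pos
    (fun z hz => by simpa using hzeros z hz)
  exact ⟨z, by simpa using hz, hgz⟩

/-- **Grace's theorem for the closed unit disk.** [cite: BorceaBranden2009II, §5 Thm. 5.1 (`C = 𝔻̄`)] -/
theorem exists_root_norm_le_one_of_apolar {n : ℕ} {f g : Polynomial ℂ} (hf : f.natDegree = n) (hf0 : f ≠ 0)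
    (hg : g.natDegree ≤ n) (h : apolarForm n f g = 0) (hzeros : ∀ z : ℂ, f.eval z = 0 → ‖z‖ ≤ 1) :
    ∃ z : ℂ, ‖z‖ ≤ 1 ∧ g.eval z = 0 := by
  obtain ⟨z, hz, hgz⟩ := exists_root_of_apolar_of_roots_mem_closedBall hf hf0 hg h 0 one_pos
    (fun z hz => by simpa using hzeros z hz)
  exact ⟨z, by simpa using hz, hgz⟩

end Grace

/-! ## §2 Theorem 5.2 for `C = 𝔻` -/

section Stable

/-- **Borcea–Brändén II, Theorem 5.2, for the open unit disk** (univariate): if `deg g ≤ n = deg f`, `f` is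
`(ℂ ∖ 𝔻)`-stable (`f(z) ≠ 0` for `|z| ≥ 1`, so all zeros of `f` lie in `𝔻`) and `g` is `𝔻`-stable
(`g(z) ≠ 0` for `|z| < 1`), then `{f,g}_n ≠ 0`. [cite: BorceaBranden2009II, §5 Thm. 5.2 (`C = ℂ ∖ 𝔻`,
resp. `C = 𝔻` after `{g,f}_n = ±{f,g}_n`)] -/
theorem apolarForm_ne_zero_of_diskStable {n : ℕ} {f g : Polynomial ℂ} (hf : f.natDegree = n) (hf0 : f ≠ 0)
    (hg : g.natDegree ≤ n) (hfs : ∀ z : ℂ, 1 ≤ ‖z‖ → f.eval z ≠ 0) (hgs : ∀ z : ℂ, ‖z‖ < 1 → g.eval z ≠ 0) :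
    apolarForm n f g ≠ 0 := fun h => by
  obtain ⟨z, hz, hgz⟩ := exists_root_norm_lt_one_of_apolar hf hf0 hg h
    (fun z hz => not_le.1 fun h1 => hfs z h1 hz)
  exact hgs z hz hgz

/-- **Theorem 5.2 for `C = 𝔻`, the other order**: `deg f ≤ n = deg g`, `f` `𝔻`-stable and `g`
`(ℂ ∖ 𝔻)`-stable ⟹ `{f,g}_n ≠ 0`. [cite: BorceaBranden2009II, §5 Thm. 5.2 (`C = 𝔻`)] -/
theorem apolarForm_ne_zero_of_diskStable' {n : ℕ} {f g : Polynomial ℂ} (hf : f.natDegree ≤ n)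
    (hg : g.natDegree = n) (hg0 : g ≠ 0) (hfs : ∀ z : ℂ, ‖z‖ < 1 → f.eval z ≠ 0)
    (hgs : ∀ z : ℂ, 1 ≤ ‖z‖ → g.eval z ≠ 0) : apolarForm n f g ≠ 0 := fun h => by
  have h' : apolarForm n g f = 0 := by rw [apolarForm_symm, h, mul_zero]
  exact apolarForm_ne_zero_of_diskStable hg hg0 hf hgs hfs h'

/-- **Theorem 5.2 for the closed unit disk `C = 𝔻̄`**: `deg g ≤ n = deg f`, `f` zero-free on `|z| > 1`
(all zeros in `𝔻̄`) and `g` zero-free on `𝔻̄` ⟹ `{f,g}_n ≠ 0`. [cite: BorceaBranden2009II, §5 Thm. 5.2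
(`C = 𝔻̄` closed)] -/
theorem apolarForm_ne_zero_of_closedDiskStable {n : ℕ} {f g : Polynomial ℂ} (hf : f.natDegree = n)
    (hf0 : f ≠ 0) (hg : g.natDegree ≤ n) (hfs : ∀ z : ℂ, 1 < ‖z‖ → f.eval z ≠ 0)
    (hgs : ∀ z : ℂ, ‖z‖ ≤ 1 → g.eval z ≠ 0) : apolarForm n f g ≠ 0 := fun h => by
  obtain ⟨z, hz, hgz⟩ := exists_root_norm_le_one_of_apolar hf hf0 hg h
    (fun z hz => not_lt.1 fun h1 => hfs z h1 hz)
  exact hgs z hz hgz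

end Stable

end Literature.Combinatorics.StablePolynomials

end
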